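import Literature.MathematicalPhysics.QuantumLattice.StrongCouplingBosonisation
import Literature.MathematicalPhysics.StatisticalMechanics.ComplexSpinTwoPointThermodynamicLimit
import HarnessLib

/-!
# Chiral long-range order of `β = 0` `U(N)` lattice gauge theory in the infinite volume:
# Salmhofer–Seiler's (4.43) for `⟨ψ̄ψ(0) ψ̄ψ(x)⟩` (CMP 139 (1991), Cor. 4.9, Remark 4.10 (1), §2 (2.21))

Theorems only (no definition, no named fact).  `StrongCouplingBosonisation` proves Salmhofer–Seiler's
(2.21)/(2.24): the `β = 0` `U(N)` lattice gauge theory with staggered fermions on an even torus IS the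
`U(N)` complex spin system, `⟨Φ(ψ̄ψ/2N)⟩_{S,Λ} = ⟨Φ⟩_Λ` (`fermiExpect_spinObs`), and deduces Cor. 4.9
at the gauge level in its uniform finite-volume form (`chiralLRO_gauge`).
`ComplexSpinTwoPointThermodynamicLimit` proves the printed INFINITE-VOLUME statement for the spin
system (Thm. 3.23 (1), Thm. 4.8 (4.42), Remark 4.10 (1) (4.43)).  This file merely transports the
latter through the former, so that (4.43) holds verbatim for the fermionic two-point function:

* `fermiExpect_twoPoint_eq_corrFn` — `⟨(ψ̄ψ(0)/2N)(ψ̄ψ(x)/2N)⟩_Λ = ⟨σ₀σ_x⟩_Λ = T_Λ(x)` (real);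
* **`gauge_chiralLRO_infiniteVolume`** (`1 ≤ N ≤ 4`, `ν ≥ 4`; `_staggered` for the phases (2.4)):
  for every sequence of even tori `Λ_n → ∞` (any linear orders of the sites, any link signs
  `Γ² = 1`) and every pointwise limit `T(x) = lim_n ⟨(ψ̄ψ(0)/2N)(ψ̄ψ(x̄)/2N)⟩_{Λ_n}` at `m = 0`:
  `lim_{|x|→∞, ε(x)=-1} T(x) = limsup_{x∈ℤ^ν} T(x) = 2c₀ > 0` and `T = 0` on the even sublattice —
  Remark 4.10 (1) (4.43) with Cor. 4.9 ("the `U(N)`-model has chiral LRO at `m = 0`").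

Honest framing: `β = 0`, `g₄ = 0`, finite even tori and their pointwise thermodynamic limits (which
exist along subsequences, `ComplexSpin.exists_subseq_tendsto_corrFn`); nothing about `β > 0`, the
continuum, `SU(N)` or the summit's `QCD` conjunct.

WHAT IS PRINTED (locators).  Cor. 4.9 p. 423: "For `N ≤ 4` and `ν ≥ 4`, the `U(N)`-model has chiral
LRO at `m = 0`"; Remark 4.10 (1) p. 423, (4.43):
"`limsup_{x∈ℤ^ν} (2N)^{-2}⟨ψ̄ψ(0)ψ̄ψ(x)⟩ = lim_{|x|→∞, ε(x)=-1} (2N)^{-2}⟨ψ̄ψ(0)ψ̄ψ(x)⟩ = 2c₀`";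
§2 (2.21), (2.24) p. 401.

## References

* M. Salmhofer, E. Seiler, *Proof of chiral symmetry breaking in strongly coupled lattice gauge
  theory*, Commun. Math. Phys. 139 (1991) 395–432: §2 (2.21)–(2.24), Cor. 4.9, Remark 4.10 (1).
  [SalmhoferSeiler1991]
-/

noncomputable section

namespace Literature.MathematicalPhysics.QuantumLattice

namespace StrongCoupling

open MvPolynomial Filter Topology
open Literature.Probability.LatticeModels (TorusSite Site)
open Literature.Probability.LatticeModels
open Literature.MathematicalPhysics.StatisticalMechanics
open Literature.MathematicalPhysics.StatisticalMechanics.ComplexSpin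

variable {ν : ℕ}

/-- Even and nonzero ⇒ `> 1`. [folklore] -/
private theorem one_lt_of_even {L : ℕ} [NeZero L] (hL : Even L) : 1 < L := by
  have := NeZero.ne L
  obtain ⟨k, hk⟩ := hL
  omega

/-- **(2.21)/(2.24) for the two-point function**: in `β = 0` `U(N)` lattice gauge theory with
staggered fermions on the torus (any linear order of the sites, any link signs `Γ² = 1`, `L > 1`),
`⟨(ψ̄ψ(0)/2N)(ψ̄ψ(x)/2N)⟩_Λ = T_Λ(x) = ⟨σ₀σ_x⟩_Λ`, the two-point function of the `U(N)` complex
spin system. [cite: SalmhoferSeiler1991, §2 (2.21) and (2.24)] -/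
theorem fermiExpect_twoPoint_eq_corrFn {L : ℕ} [NeZero L] [LinearOrder (TorusSite ν L)] {N : ℕ}
    (hL1 : 1 < L) (Γ : TorusSite ν L × Fin ν → ℂ) (hΓ : ∀ b, Γ b ^ 2 = 1) (m : ℝ)
    (x : TorusSite ν L) :
    fermiExpect (torusLinks ν L) Γ (m : ℂ)
        (fun _ => (((2 * N : ℂ)⁻¹ • meson 0) * ((2 * N : ℂ)⁻¹ • meson x) : FermiAlg (TorusSite ν L) N)) =
      ((corrFn N m (uNBondCoeff N) x : ℝ) : ℂ) := by
  rw [← spinObs_X_mul_X, fermiExpect_spinObs hL1 Γ hΓ m]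
  rfl

/-- **Remark 4.10 (1) (4.43) with Corollary 4.9, at the gauge level and in the thermodynamic limit.**
For `1 ≤ N ≤ 4`, `ν ≥ 4`, even tori `Λ_n = (ℤ/L_n)^ν` with `L_n → ∞` (any linear orders of the
sites, any link signs `Γ_n² = 1`) and any pointwise thermodynamic limit
`T(x) = lim_n ⟨(ψ̄ψ(0)/2N)(ψ̄ψ(x̄)/2N)⟩_{Λ_n}` of the `m = 0` two-point function of `β = 0` `U(N)`
lattice gauge theory with massless staggered fermions (`x̄ = x mod L_n`; the expectations are real,
`fermiExpect_twoPoint_eq_corrFn`): there is `c₀ > 0` with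
`lim_{|x|→∞, ε(x)=-1} T(x) = limsup_{x∈ℤ^ν} T(x) = 2c₀` and `T = 0` on the even sublattice —
chiral long-range order in the infinite volume, (4.43) as printed.  Honest scope: `β = 0`, `g₄ = 0`,
pointwise limits along even tori; nothing about `β > 0`, the continuum, `SU(N)` or the summit's
`QCD` conjunct. [cite: SalmhoferSeiler1991, Remark 4.10 (1) (4.43) with Cor. 4.9 and (2.21)] -/
theorem gauge_chiralLRO_infiniteVolume {N : ℕ} (hN1 : 1 ≤ N) (hN4 : N ≤ 4) (hν : 4 ≤ ν)
    (Ls : ℕ → ℕ) [∀ n, NeZero (Ls n)] [∀ n, LinearOrder (TorusSite ν (Ls n))]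
    (hev : ∀ n, Even (Ls n)) (hLs : Tendsto Ls atTop atTop)
    (Γ : ∀ n, TorusSite ν (Ls n) × Fin ν → ℂ) (hΓ : ∀ n b, Γ n b ^ 2 = 1) {T : Site ν → ℝ}
    (hT : ∀ x, Tendsto (fun n => (fermiExpect (torusLinks ν (Ls n)) (Γ n) ((0 : ℝ) : ℂ)
      (fun _ => (((2 * N : ℂ)⁻¹ • meson 0) * ((2 * N : ℂ)⁻¹ • meson (Torus.proj (Ls n) x)) :
        FermiAlg (TorusSite ν (Ls n)) N))).re) atTop (nhds (T x))) :
    ∃ c₀ : ℝ, 0 < c₀ ∧ (∀ x, latSgn x = 1 → T x = 0) ∧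
      Tendsto T (cofinite ⊓ 𝓟 {x | latSgn x = -1}) (nhds (2 * c₀)) ∧
      Filter.limsup T cofinite = 2 * c₀ := by
  have hT' : ∀ x, Tendsto (fun n => corrFn (L := Ls n) N 0 (uNBondCoeff N) (Torus.proj (Ls n) x))
      atTop (nhds (T x)) := by
    intro x
    refine (hT x).congr fun n => ?_
    rw [fermiExpect_twoPoint_eq_corrFn (one_lt_of_even (hev n)) (Γ n) (hΓ n) 0, Complex.ofReal_re]
  obtain ⟨c₀, hc0, -, heven, hTodd, hlimsup⟩ :=
    uN_chiralLRO_thermodynamicLimit Ls hN1 hN4 hν hev hLs hT'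
  exact ⟨c₀, hc0, heven, hTodd, hlimsup⟩

/-- The expectations in question are real: `Im ⟨(ψ̄ψ(0)/2N)(ψ̄ψ(x)/2N)⟩_Λ = 0`.
[cite: SalmhoferSeiler1991, §2 (2.21)] -/
theorem fermiExpect_twoPoint_im {L : ℕ} [NeZero L] [LinearOrder (TorusSite ν L)] {N : ℕ}
    (hL1 : 1 < L) (Γ : TorusSite ν L × Fin ν → ℂ) (hΓ : ∀ b, Γ b ^ 2 = 1) (m : ℝ)
    (x : TorusSite ν L) :
    (fermiExpect (torusLinks ν L) Γ (m : ℂ)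
        (fun _ => (((2 * N : ℂ)⁻¹ • meson 0) * ((2 * N : ℂ)⁻¹ • meson x) :
          FermiAlg (TorusSite ν L) N))).im = 0 := by
  rw [fermiExpect_twoPoint_eq_corrFn hL1 Γ hΓ m, Complex.ofReal_im]

/-- **The same for the staggered action itself** (link signs `Γ_μ(x)` of (2.4), `e^{-S_F} = exp(ψ̄(-D)ψ)`
with the tree's `staggeredDirac`, cf. `fermiBoltzmann_torus_eq_staggeredDirac`): every thermodynamic
limit of `⟨(ψ̄ψ(0)/2N)(ψ̄ψ(x̄)/2N)⟩_Λ` at `m = 0`, `β = 0`, `1 ≤ N ≤ 4`, `ν ≥ 4`, has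
`lim_{|x|→∞, ε(x)=-1} T(x) = limsup_x T(x) = 2c₀ > 0`. [cite: SalmhoferSeiler1991, Remark 4.10 (1) (4.43) with Cor. 4.9 and (2.3)–(2.4)] -/
theorem gauge_chiralLRO_infiniteVolume_staggered {N : ℕ} (hN1 : 1 ≤ N) (hN4 : N ≤ 4) (hν : 4 ≤ ν)
    (Ls : ℕ → ℕ) [∀ n, NeZero (Ls n)] [∀ n, LinearOrder (TorusSite ν (Ls n))]
    (hev : ∀ n, Even (Ls n)) (hLs : Tendsto Ls atTop atTop) {T : Site ν → ℝ}
    (hT : ∀ x, Tendsto (fun n => (fermiExpect (torusLinks ν (Ls n))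
      (fun p => ((staggeredPhase p.1 p.2 : ℤ) : ℂ)) ((0 : ℝ) : ℂ)
      (fun _ => (((2 * N : ℂ)⁻¹ • meson 0) * ((2 * N : ℂ)⁻¹ • meson (Torus.proj (Ls n) x)) :
        FermiAlg (TorusSite ν (Ls n)) N))).re) atTop (nhds (T x))) :
    ∃ c₀ : ℝ, 0 < c₀ ∧ (∀ x, latSgn x = 1 → T x = 0) ∧
      Tendsto T (cofinite ⊓ 𝓟 {x | latSgn x = -1}) (nhds (2 * c₀)) ∧
      Filter.limsup T cofinite = 2 * c₀ :=
  gauge_chiralLRO_infiniteVolume hN1 hN4 hν Ls hev hLs (fun _ p => ((staggeredPhase p.1 p.2 : ℤ) : ℂ))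
    (fun _ p => staggeredPhase_sq p.1 p.2) hT

end StrongCoupling

end Literature.MathematicalPhysics.QuantumLattice

end
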